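import Summits.AtomisticToContinuum.HydrodynamicLimit.Theorems.OneFlightGossipEngineEnergyCurrentTailsLevelCensusForwardWindow
import Summits.AtomisticToContinuum.HydrodynamicLimit.Theorems.JParityClosureOddContactSymmetryGibbsInvariance
import Summits.AtomisticToContinuum.HydrodynamicLimit.Theorems.JParityClosureCollisionTightnessSweptTube
import Summits.AtomisticToContinuum.HydrodynamicLimit.Theorems.JParityClosureCollisionTightnessTorusGibbs
import Literature.MathematicalPhysics.KineticTheory.HardSphereCanonicalPairBound
import HarnessLib

/-!
# Crux `EnergyCurrentTails` (stmt-AtomisticToContinuum-9235), line `level-census-comparison`: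
# the rung-0 collision-flux bound for marks of the INCOMING velocities

Helper file (`--supports stmt-AtomisticToContinuum-9235`) of stub F1
`stub_rateCeiling : RateCeiling`, second of the three files of its rung-0 certificate
`stub_rateCeilingRung0` (previous: `…LevelCensusForwardWindow`, the pathwise forward window bound
and the forward window event; next: `…LevelCensusRateCeilingRung0`, the certificate).  Contents:

* `lintegral_le_liminf_of_le_collisionPreMarkSum` — the forward window bound in EXPECTATION form
  for a law preserved by every flow map and carried by the good set (any geometry with continuous
  translations and Hausdorff positions): every `f` dominated on the good set by the collision pair
  sum over `(0, τ]` of a mark `A(vᵢ⁻, vⱼ⁻)` of the incoming velocities along the orbit of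
  `Φ_{t₀} z` has `∫ f dP ≤ liminf_M M · ∫ Σ_{i≠j} 𝟙_{E M i j} A(vᵢ, vⱼ) dP` (pathwise grid
  majorant `sum_collision_pre_le_sum_window`, Fatou, stationarity — the proof of
  `…QuarticSchurLedger.lintegral_le_liminf_of_le_collisionPairSum` with the grid `k = 0, …, M − 1`);
* `localGibbsLaw_lintegral_le_of_le_collisionPreMarkSum` (registered main theorem of this file) —
  its RUNG-0 specialisation on `𝕋³`: at small reduced density, for constant profiles and `N ≥ 1`,
  `∫ f dG_N ≤ 16 τ (N+1)² ε_N² ∫ ‖v − w‖ A(v, w) dN(u,θ)^{⊗2}` (Gibbs invariance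
  `measurePreserving_flow_localGibbsLaw_const`, the forward window event `exists_windowEvent_fwd`
  fed with the pair bound `posGibbs_pairEvent_le`, the swept tubes `exists_sweptTube` and the lifts
  `volume_setOf_exists_reprSym_add_latticeVec_mem_le`; the mesh cancels exactly, `M · (τ/M) = τ`);
* `ite_indicator_le_mark`, `collisionSum_ite_indicator_le_collisionPreMarkSum` — PATHWISE: the
  guarded count of collisions in `(s, s′]` whose velocity event lies in `S` is at most the collision
  pair sum over `(0, s′ − s]` of any incoming mark `A ≥ 𝟙_S` along the orbit of `Φ_s z`;
* `lintegral_sum_vel_localGibbsLaw_const` — STATICS: at rung 0 the one-particle velocity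
  statistics are Gaussian at every time, `∫ Σᵢ g(vᵢ(Φ_r z)) dG_N = (N+1) ∫ g dN(u,θ)`.

References: C. Cercignani, R. Illner, M. Pulvirenti, *The Mathematical Theory of Dilute Gases*
(1994), App. 4.A; I. Gallagher, L. Saint-Raymond, B. Texier, *From Newton to Boltzmann* (2013),
Prop. 4.1.1.
-/

noncomputable section

open MeasureTheory Set Filter Topology Function
open scoped ENNReal InnerProductSpace BigOperators

namespace Summit.AtomisticToContinuum.HydrodynamicLimit.Theorems.EnergyCurrentTailsLevelCensus

open Literature.MathematicalPhysics.KineticTheory Literature.Analysis.FluidPDE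
open Literature.Analysis.FunctionSpaces

/-! ### The window bound in expectation form, incoming marks -/

/-- **The window bound for collision sums of INCOMING marks under a flow-invariant law —
expectation form.**  Let `Φ` be a hard-sphere flow (continuous translations, Hausdorff positions),
`P` a law preserved by every `Φ_t` and carried by the good set, `τ > 0`, `A` a measurable
`ℝ≥0∞`-valued mark of two velocities, and `E M i j` measurable one-window events containing every
non-overlapping `w` whose pair `(i, j)` reaches contact under a FORWARD free flight of duration
`t ∈ [0, τ/M]`.  Then every `f` dominated on the good set by the collision pair sum over `(0, τ]` of
`A(vᵢ⁻, vⱼ⁻)` (incoming velocities of the ordered contact pairs) ALONG THE ORBIT OF `Φ_{t₀} z` has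
`∫ f dP ≤ liminf_M M · ∫ Σ_{i≠j} 𝟙_{E M i j}(w) A(vᵢ, vⱼ) dP` (grid majorant
`sum_collision_pre_le_sum_window`, Fatou, stationarity). [folklore] -/
theorem lintegral_le_liminf_of_le_collisionPreMarkSum {d X : Type*} [Fintype d] [MeasureSpace X]
    [TopologicalSpace X] [T2Space X] {G : Geometry d X} {ε : ℝ} {n : ℕ} (Φ : HardSphereFlow G ε n)
    (hG : ∀ x : X, Continuous (G.translate x))
    (P : Measure (Config n d X)) (hstat : ∀ t : ℝ, MeasurePreserving (Φ.flow t) P P)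
    (hgood : ∀ᵐ z ∂P, z ∈ Φ.good) {τ : ℝ} (hτ : 0 < τ)
    {A : EuclideanSpace ℝ d × EuclideanSpace ℝ d → ℝ≥0∞} (hAm : Measurable A)
    (E : ℕ → Fin n → Fin n → Set (Config n d X)) (hEm : ∀ M i j, MeasurableSet (E M i j))
    (hE : ∀ (M : ℕ) (i j : Fin n), i ≠ j → ∀ w ∈ hardSphereDomain G n ε, ∀ t ∈ Icc 0 (τ / M),
      ‖G.sepVec ((freeFlight G t w i).1) ((freeFlight G t w j).1)‖ = ε → w ∈ E M i j)
    (t₀ : ℝ) {f : Config n d X → ℝ≥0∞}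
    (hf : ∀ z ∈ Φ.good, f z ≤ Φ.collisionPairSum (Ioc 0 τ)
      (fun _ w i j => A (reflectVel (G.sepVec (w i).1 (w j).1) ((w i).2, (w j).2))) (Φ.flow t₀ z)) :
    ∫⁻ z, f z ∂P ≤ liminf (fun M : ℕ => (M : ℝ≥0∞) *
        ∫⁻ w, ∑ i, ∑ j, (if i ≠ j then (E M i j).indicator (fun w => A ((w i).2, (w j).2)) w else 0)
          ∂P) atTop := by
  classical
  -- the one-window functional, the grid sums and their measurable `liminf`
  set W : ℕ → Config n d X → ℝ≥0∞ := fun M w => ∑ i, ∑ j,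
    (if i ≠ j then (E M i j).indicator (fun w => A ((w i).2, (w j).2)) w else 0) with hWdef
  have hAm' : ∀ i j : Fin n, Measurable fun w : Config n d X => A ((w i).2, (w j).2) :=
    fun i j => hAm.comp ((measurable_pi_apply i).snd.prodMk (measurable_pi_apply j).snd)
  have hWm : ∀ M, Measurable (W M) := fun M =>
    Finset.measurable_sum _ fun i _ => Finset.measurable_sum _ fun j _ => by
      split_ifs; exacts [(hAm' i j).indicator (hEm M i j), measurable_const]
  set SM : ℕ → Config n d X → ℝ≥0∞ := fun M z =>
    ∑ k ∈ Finset.range M, W M (Φ.flow ((k : ℝ) * (τ / M)) z) with hSMdef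
  have hSMm : ∀ M, Measurable (SM M) := fun M =>
    Finset.measurable_sum _ fun k _ => (hWm M).comp (Φ.measurable_flow _)
  set Kstar : Config n d X → ℝ≥0∞ := fun z => liminf (fun M => SM M z) atTop with hKdef
  have hKm : Measurable Kstar := Measurable.liminf hSMm
  -- (i) the pathwise bound on the good set
  have hpath : ∀ w ∈ Φ.good, Φ.collisionPairSum (Ioc 0 τ)
      (fun _ w i j => A (reflectVel (G.sepVec (w i).1 (w j).1) ((w i).2, (w j).2))) w ≤
        Kstar w := by
    intro w hw
    have hγ := Φ.isTrajectory w hw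
    have hfin : (collisionTimes G ε (fun t => Φ.flow t w) ∩ Ioc 0 τ).Finite :=
      hγ.finite_collisionTimes_inter_of_subset_Icc Ioc_subset_Icc_self
    rw [Φ.collisionPairSum_eq_finsum_ite hw, finsum_mem_eq_finite_toFinset_sum _ hfin]
    obtain ⟨g, hg, hgap⟩ := exists_gap_of_finite (hγ.locFinite 0 τ)
    show _ ≤ liminf (fun M => SM M w) atTop
    refine le_liminf_of_le (h := ?_)
    filter_upwards [eventually_gt_atTop ⌈τ / g⌉₊] with M hM
    have hM0 : 0 < M := lt_of_le_of_lt (Nat.zero_le _) hM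
    have hMg : τ / M < g := by
      have h1 : τ / g < M := (Nat.le_ceil _).trans_lt (by exact_mod_cast hM)
      rw [div_lt_iff₀ hg] at h1
      rw [div_lt_iff₀ (by exact_mod_cast hM0)]
      linarith
    have hgap' : ∀ s ∈ collisionTimes G ε (fun t => Φ.flow t w) ∩ Icc 0 τ,
        ∀ s' ∈ collisionTimes G ε (fun t => Φ.flow t w) ∩ Icc 0 τ, s < s' → τ / M < s' - s :=
      fun s hs s' hs' hlt => hMg.trans_le (hgap s hs s' hs' hlt)
    exact sum_collision_pre_le_sum_window hγ hG hτ hM0 hgap' hfin (E M) (hE M) A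
  -- (ii) the mean of each grid sum (stationarity) and Fatou
  have hmeanM : ∀ M, ∫⁻ z, SM M z ∂P = (M : ℝ≥0∞) * ∫⁻ w, W M w ∂P := by
    intro M
    calc ∫⁻ z, SM M z ∂P = ∑ k ∈ Finset.range M, ∫⁻ z, W M (Φ.flow ((k : ℝ) * (τ / M)) z) ∂P :=
          lintegral_finsetSum _ fun k _ => (hWm M).comp (Φ.measurable_flow _)
      _ = ∑ _k ∈ Finset.range M, ∫⁻ z, W M z ∂P :=
          Finset.sum_congr rfl fun k _ => (hstat _).lintegral_comp (hWm M)
      _ = (M : ℝ≥0∞) * ∫⁻ w, W M w ∂P := by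
          rw [Finset.sum_const, Finset.card_range, nsmul_eq_mul]
  have hmean : ∫⁻ z, Kstar z ∂P ≤ liminf (fun M : ℕ => (M : ℝ≥0∞) * ∫⁻ w, W M w ∂P) atTop := by
    refine (lintegral_liminf_le hSMm).trans (le_of_eq ?_)
    exact congrArg (fun u : ℕ → ℝ≥0∞ => liminf u atTop) (funext hmeanM)
  -- (iii) a.e. domination by `K⋆ ∘ Φ_{t₀}` and stationarity once more
  have hae : ∀ᵐ z ∂P, f z ≤ Kstar (Φ.flow t₀ z) := by
    filter_upwards [hgood] with z hz
    exact (hf z hz).trans (hpath _ (Φ.mapsTo_good t₀ hz))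
  calc ∫⁻ z, f z ∂P ≤ ∫⁻ z, Kstar (Φ.flow t₀ z) ∂P := lintegral_mono_ae hae
    _ = ∫⁻ z, Kstar z ∂P := (hstat t₀).lintegral_comp hKm
    _ ≤ _ := hmean

/-! ### The rung-0 bound for collision sums of incoming marks -/

/-- **Registered main theorem `localGibbsLaw_lintegral_le_of_le_collisionPreMarkSum` — rung-0
collision-flux bound for INCOMING marks, expectation form.**  At small reduced density
(`SmallDensity uniformProfile σ`), for constant profiles `a, θ > 0`, `u`, `N ≥ 1`, a flow `Φ` of
`N + 1` spheres of diameter `ε_N = hsDiameter σ N` on `𝕋³`, `τ > 0` and a measurable `ℝ≥0∞`-valued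
mark `A` of two velocities: every `f` dominated on the good set by the collision pair sum over
`(0, τ]` of `A(vᵢ⁻, vⱼ⁻)` (incoming velocities `reflectVel` of the ordered contact pairs) along the
orbit of `Φ_{t₀} z` has `∫ f dG_N ≤ 16 τ (N+1)² ε_N² · ∫ ‖v − w‖ A(v, w) dN(u,θ)^{⊗2}` under the
homogeneous Gibbs law `G_N` (invariant under every flow map,
`measurePreserving_flow_localGibbsLaw_const`; pair bound `posGibbs_pairEvent_le`, swept tubes
`exists_sweptTube`, lifts `volume_setOf_exists_reprSym_add_latticeVec_mem_le`;
Cercignani–Illner–Pulvirenti 1994, App. 4.A, read before the collision instead of after it).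
[folklore] -/
theorem localGibbsLaw_lintegral_le_of_le_collisionPreMarkSum : ∀ {σ : ℝ},
    SmallDensity uniformProfile σ → ∀ {a θ : ℝ}, 0 < a → 0 < θ → ∀ (u : V3) {N : ℕ}, 1 ≤ N →
    ∀ (Φ : HardSphereFlow (Torus.geometry (Fin 3)) (hsDiameter σ N) (N + 1)) {τ : ℝ}, 0 < τ →
    ∀ {A : V3 × V3 → ℝ≥0∞}, Measurable A → ∀ (t₀ : ℝ) {f : Config (N + 1) (Fin 3) T3 → ℝ≥0∞},
    (∀ z ∈ Φ.good, f z ≤ Φ.collisionPairSum (Ioc 0 τ)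
      (fun _ w i j => A (reflectVel ((Torus.geometry (Fin 3)).sepVec (w i).1 (w j).1)
        ((w i).2, (w j).2))) (Φ.flow t₀ z)) →
    ∫⁻ z, f z ∂(localGibbsLaw σ (fun _ => a) (fun _ => u) (fun _ => θ) N Φ) ≤
      ENNReal.ofReal (16 * τ * ((N + 1 : ℕ) : ℝ) ^ 2 * hsDiameter σ N ^ 2) *
        ∫⁻ p, ENNReal.ofReal ‖p.1 - p.2‖ * A p ∂((gaussMeasure u θ).prod (gaussMeasure u θ)) := by
  intro σ hsm a θ ha hθ u N hN Φ τ hτ A hAm t₀ f hf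
  classical
  set P := localGibbsLaw σ (fun _ => a) (fun _ => u) (fun _ => θ) N Φ with hPdef
  set I : ℝ≥0∞ := ∫⁻ p, ENNReal.ofReal ‖p.1 - p.2‖ * A p
    ∂((gaussMeasure u θ).prod (gaussMeasure u θ)) with hIdef
  have hσ2 : σ ≤ 1 / 2 := hsm.σ_lt_half.le
  have hε : 0 < hsDiameter σ N := hsDiameter_pos hsm.σ_pos N
  have hAm' : ∀ i j : Fin (N + 1), Measurable fun w : Config (N + 1) (Fin 3) T3 =>
      A ((w i).2, (w j).2) :=
    fun i j => hAm.comp ((measurable_pi_apply i).snd.prodMk (measurable_pi_apply j).snd)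
  -- the forward window events, for every mesh `τ / M` and every ordered pair
  have hev : ∀ (M : ℕ) (i j : Fin (N + 1)), ∃ E : Set (Config (N + 1) (Fin 3) T3),
      MeasurableSet E ∧
      (i ≠ j → ∀ w ∈ hardSphereDomain (Torus.geometry (Fin 3)) (N + 1) (hsDiameter σ N),
        ∀ t ∈ Icc 0 (τ / M),
        ‖(Torus.geometry (Fin 3)).sepVec ((freeFlight (Torus.geometry (Fin 3)) t w i).1)
          ((freeFlight (Torus.geometry (Fin 3)) t w j).1)‖ = hsDiameter σ N → w ∈ E) ∧
      (i ≠ j → ∫⁻ w, E.indicator (fun w => A ((w i).2, (w j).2)) w ∂P ≤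
        ENNReal.ofReal (16 * hsDiameter σ N ^ 2 * (τ / M)) * I) := by
    intro M i j
    by_cases hij : i ≠ j
    · have hh : 0 ≤ τ / M := div_nonneg hτ.le (Nat.cast_nonneg M)
      obtain ⟨S, hSm, hSvol, hS⟩ := exists_sweptTube hε hh
      obtain ⟨E, hEm, hEc, hEb⟩ :=
        exists_windowEvent_fwd hσ2 ha hθ u hh hij (fun T hT => posGibbs_pairEvent_le hsm hN hij hT)
          hSm hSvol hS (fun B hB => by
            simpa only [sub_zero] using volume_setOf_exists_reprSym_add_latticeVec_mem_le 0 hB)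
      exact ⟨E, hEm, fun _ => hEc, fun _ => hEb Φ A hAm⟩
    · exact ⟨∅, MeasurableSet.empty, fun h => absurd h hij, fun h => absurd h hij⟩
  choose E hEm hEc hEb using hev
  -- the general window bound in expectation form
  have hgood : ∀ᵐ z ∂P, z ∈ Φ.good := by
    refine mem_ae_iff.2 ?_
    rw [hPdef, localGibbsLaw_eq]
    exact localGibbsMeasure_absolutelyContinuous σ _ _ _ N Φ Φ.measure_compl_good
  have hreg : (Torus.geometry (Fin 3)).IsHardSphereRegular (hsDiameter σ N) :=
    Torus.isHardSphereRegular_geometry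
      (by linarith [hsDiameter_le hsm.σ_pos.le N, hsm.σ_lt_half, (by norm_num : (2⁻¹ : ℝ) = 1 / 2)])
  have hG : ∀ x : T3, Continuous ((Torus.geometry (Fin 3)).translate x) := fun x =>
    hreg.continuous_translate.comp (continuous_const.prodMk continuous_id)
  have hgen := lintegral_le_liminf_of_le_collisionPreMarkSum Φ hG P
    (measurePreserving_flow_localGibbsLaw_const σ a θ u N Φ) hgood hτ hAm
    (fun M i j => E M i j) hEm (fun M i j hij => hEc M i j hij) t₀ hf
  -- the mean of one window: the static bound, `(N+1)²` ordered pairs, and `M · (τ/M) = τ`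
  have hB : ∀ M : ℕ, (M : ℝ≥0∞) * ∫⁻ w, ∑ i, ∑ j,
      (if i ≠ j then (E M i j).indicator (fun w => A ((w i).2, (w j).2)) w else 0) ∂P ≤
        ENNReal.ofReal (16 * τ * ((N + 1 : ℕ) : ℝ) ^ 2 * hsDiameter σ N ^ 2) * I := by
    intro M
    rcases Nat.eq_zero_or_pos M with hM0 | hM0
    · subst hM0
      simp only [Nat.cast_zero, zero_mul, zero_le]
    have hM' : (0 : ℝ) < M := by exact_mod_cast hM0
    have hterm : ∀ i j : Fin (N + 1), ∫⁻ w, (if i ≠ j then (E M i j).indicator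
        (fun w => A ((w i).2, (w j).2)) w else 0) ∂P ≤
          ENNReal.ofReal (16 * hsDiameter σ N ^ 2 * (τ / M)) * I :=
      fun i j => by
        split_ifs with hij
        exacts [hEb M i j hij, by simp only [lintegral_zero, zero_le]]
    have hmeas : ∀ i j : Fin (N + 1), Measurable fun w : Config (N + 1) (Fin 3) T3 =>
        (if i ≠ j then (E M i j).indicator (fun w => A ((w i).2, (w j).2)) w else 0) :=
      fun i j => by split_ifs; exacts [(hAm' i j).indicator (hEm M i j), measurable_const]
    calc (M : ℝ≥0∞) * ∫⁻ w, ∑ i, ∑ j,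
          (if i ≠ j then (E M i j).indicator (fun w => A ((w i).2, (w j).2)) w else 0) ∂P
        = (M : ℝ≥0∞) * ∑ i, ∑ j, ∫⁻ w,
            (if i ≠ j then (E M i j).indicator (fun w => A ((w i).2, (w j).2)) w else 0) ∂P := by
          congr 1
          rw [lintegral_finsetSum _ fun i _ => Finset.measurable_sum _ fun j _ => hmeas i j]
          exact Finset.sum_congr rfl fun i _ => lintegral_finsetSum _ fun j _ => hmeas i j
      _ ≤ (M : ℝ≥0∞) * ∑ _i : Fin (N + 1), ∑ _j : Fin (N + 1),
            ENNReal.ofReal (16 * hsDiameter σ N ^ 2 * (τ / M)) * I := by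
          gcongr with i _ j _
          exact hterm i j
      _ = ENNReal.ofReal (16 * τ * ((N + 1 : ℕ) : ℝ) ^ 2 * hsDiameter σ N ^ 2) * I := by
          simp only [Finset.sum_const, Finset.card_univ, Fintype.card_fin, nsmul_eq_mul]
          rw [← ENNReal.ofReal_natCast M, ← ENNReal.ofReal_natCast (N + 1), ← mul_assoc,
            ← mul_assoc, ← mul_assoc, ← ENNReal.ofReal_mul (Nat.cast_nonneg _),
            ← ENNReal.ofReal_mul (by positivity), ← ENNReal.ofReal_mul (by positivity)]
          congr 1
          congr 1
          field_simp
  exact hgen.trans (liminf_le_of_frequently_le' (Frequently.of_forall hB))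

/-! ### Pathwise: guarded velocity-event counts are collision sums of incoming marks -/

/-- A guarded indicator of a velocity event lying in `S` is at most any mark `A` of the incoming
velocities with `A ≥ 1` on (the incoming part of) `S`. [folklore] -/
theorem ite_indicator_le_mark {N : ℕ} (S : Set ((V3 × V3) × (V3 × V3))) {A : V3 × V3 → ℝ≥0∞}
    (hA : ∀ q ∈ S, 1 ≤ A q.1) (c : HardSphereCollisionRecord (Fin 3) T3 (N + 1)) :
    (if c.fst < c.snd then S.indicator (fun _ => (1 : ℝ≥0∞)) (c.preVel, c.postVel) else 0) ≤
      A c.preVel := by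
  split_ifs
  · by_cases hq : (c.preVel, c.postVel) ∈ S
    · rw [indicator_of_mem hq]; exact hA _ hq
    · rw [indicator_of_notMem hq]; exact bot_le
  · exact bot_le

/-- **Pathwise domination of a window's guarded velocity-event count.**  On a good orbit, the number
of collisions in `(s, s′]` whose velocity event `((vᵢ⁻, vⱼ⁻), (vᵢ⁺, vⱼ⁺))` lies in `S` (guard
`fst < snd`) is at most the collision pair sum over `(0, s′ − s]` of any mark `A(vᵢ⁻, vⱼ⁻) ≥ 𝟙_S` of
the incoming velocities along the orbit of `Φ_s z` (group property: collision times shift by `s`).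
[folklore] -/
theorem collisionSum_ite_indicator_le_collisionPreMarkSum {σ : ℝ} {N : ℕ}
    (Φ : HardSphereFlow (Torus.geometry (Fin 3)) (hsDiameter σ N) (N + 1))
    {z : Config (N + 1) (Fin 3) T3} (hz : z ∈ Φ.good) (s s' : ℝ) (S : Set ((V3 × V3) × (V3 × V3)))
    {A : V3 × V3 → ℝ≥0∞} (hA : ∀ q ∈ S, 1 ≤ A q.1) :
    Φ.collisionSum (Ioc s s')
        (fun c => if c.fst < c.snd then S.indicator (fun _ => (1 : ℝ≥0∞)) (c.preVel, c.postVel)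
          else 0) z ≤
      Φ.collisionPairSum (Ioc 0 (s' - s))
        (fun _ w i j => A (reflectVel ((Torus.geometry (Fin 3)).sepVec (w i).1 (w j).1)
          ((w i).2, (w j).2))) (Φ.flow s z) := by
  rw [HardSphereFlow.collisionSum_eq, collisionSum_eq_collisionPairSum]
  set γ : ℝ → Config (N + 1) (Fin 3) T3 := fun r => Φ.flow r z with hγ
  have hγt : IsHardSphereTrajectory (Torus.geometry (Fin 3)) (hsDiameter σ N) (N + 1) γ :=
    Φ.isTrajectory z hz
  have hfin1 : (collisionTimes (Torus.geometry (Fin 3)) (hsDiameter σ N) γ ∩ Ioc s s').Finite :=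
    hγt.finite_collisionTimes_inter_of_subset_Icc Ioc_subset_Icc_self
  set m : ℝ → Fin (N + 1) → Fin (N + 1) → ℝ≥0∞ := fun t i j =>
    A (reflectVel ((Torus.geometry (Fin 3)).sepVec (γ t i).1 (γ t j).1) ((γ t i).2, (γ t j).2))
    with hm
  -- (1) termwise domination
  have h1 : collisionPairSum (Torus.geometry (Fin 3)) (hsDiameter σ N) γ (Ioc s s')
      (fun t i j => (fun c : HardSphereCollisionRecord (Fin 3) T3 (N + 1) =>
        if c.fst < c.snd then S.indicator (fun _ => (1 : ℝ≥0∞)) (c.preVel, c.postVel) else 0)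
        (HardSphereCollisionRecord.ofConfig (Torus.geometry (Fin 3)) (hsDiameter σ N) (γ t) t
          i j)) ≤
      collisionPairSum (Torus.geometry (Fin 3)) (hsDiameter σ N) γ (Ioc s s') m := by
    rw [collisionPairSum_eq_finset_sum hfin1, collisionPairSum_eq_finset_sum hfin1]
    exact Finset.sum_le_sum fun t _ => Finset.sum_le_sum fun p _ => ite_indicator_le_mark S hA _
  -- (2) the shift `Φ_r (Φ_s z) = Φ_{r+s} z`
  have hfa : ∀ r, Φ.flow r (Φ.flow s z) = γ (r + s) := fun r => (Φ.flow_add r s z hz).symm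
  have h2 : collisionPairSum (Torus.geometry (Fin 3)) (hsDiameter σ N) γ (Ioc s s') m =
      Φ.collisionPairSum (Ioc 0 (s' - s))
        (fun _ w i j => A (reflectVel ((Torus.geometry (Fin 3)).sepVec (w i).1 (w j).1)
          ((w i).2, (w j).2))) (Φ.flow s z) := by
    unfold HardSphereFlow.collisionPairSum
    simp only [hfa]
    unfold collisionPairSum
    symm
    refine finsum_mem_eq_of_bijOn (fun r => r + s) ⟨?_, ?_, ?_⟩ fun r _ => rfl
    · rintro r ⟨hr, h0, hrh⟩
      exact ⟨hr, by linarith, by linarith⟩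
    · exact fun r _ r' _ hrr' => by simpa using hrr'
    · rintro t ⟨ht, hts, hth⟩
      refine ⟨t - s, ⟨?_, by linarith, by linarith⟩, sub_add_cancel t s⟩
      show t - s + s ∈ collisionTimes (Torus.geometry (Fin 3)) (hsDiameter σ N) γ
      rwa [sub_add_cancel]
  exact h1.trans_eq h2

/-! ### Statics: one-particle velocity marginals of the homogeneous Gibbs law at any time -/

/-- **One-particle velocity statistics at rung 0 are Gaussian at every time.**  For `σ ≤ 1/2`,
constant profiles `a, θ > 0`, `u`, every flow `Φ`, every time `r` and every measurable
`g : V3 → ℝ≥0∞`: `∫ Σᵢ g(vᵢ(Φ_r z)) dG_N(z) = (N + 1) ∫ g dN(u,θ)` (invariance of `G_N` under `Φ_r`,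
`measurePreserving_flow_localGibbsLaw_const`, and `G_N = posGibbs ⊗ N(u,θ)^{⊗(N+1)}`,
`localGibbsMeasure_rung0_eq_map`). [folklore] -/
theorem lintegral_sum_vel_localGibbsLaw_const {σ : ℝ} (hσ2 : σ ≤ 1 / 2) {a θ : ℝ} (ha : 0 < a)
    (hθ : 0 < θ) (u : V3) (N : ℕ)
    (Φ : HardSphereFlow (Torus.geometry (Fin 3)) (hsDiameter σ N) (N + 1)) (r : ℝ)
    {g : V3 → ℝ≥0∞} (hg : Measurable g) :
    ∫⁻ z, (∑ i : Fin (N + 1), g ((Φ.flow r z i).2))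
        ∂(localGibbsLaw σ (fun _ => a) (fun _ => u) (fun _ => θ) N Φ) =
      (((N + 1 : ℕ) : ℝ≥0∞)) * ∫⁻ v, g v ∂(gaussMeasure u θ) := by
  have hm : Measurable fun z : Config (N + 1) (Fin 3) T3 => ∑ i : Fin (N + 1), g ((z i).2) :=
    Finset.measurable_sum _ fun i _ => hg.comp (measurable_pi_apply i).snd
  rw [lintegral_comp_flow_localGibbsLaw_const σ a θ u N Φ r hm, localGibbsLaw_eq,
    localGibbsMeasure_rung0_eq_map σ ha.le hθ u N, lintegral_map hm measurable_zipConfig]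
  set Q := posGibbsMeasure (fun _ : T3 => a) (hsDiameter σ N) (N + 1) with hQ
  haveI : IsProbabilityMeasure Q :=
    isProbabilityMeasure_posGibbsMeasure continuous_const (fun _ => ha) hσ2 N
  set Γ : Measure (Fin (N + 1) → V3) := Measure.pi fun _ => gaussMeasure u θ with hΓ
  have hG : Measurable fun v : Fin (N + 1) → V3 => ∑ i : Fin (N + 1), g (v i) :=
    Finset.measurable_sum _ fun i _ => hg.comp (measurable_pi_apply i)
  have hfun : (fun pr : (Fin (N + 1) → T3) × (Fin (N + 1) → V3) =>
      ∑ i : Fin (N + 1), g ((zipConfig pr i).2)) =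
        fun pr => (fun _ : Fin (N + 1) → T3 => (1 : ℝ≥0∞)) pr.1 *
          (fun v : Fin (N + 1) → V3 => ∑ i : Fin (N + 1), g (v i)) pr.2 := by
    funext pr
    simp only [zipConfig_apply, one_mul]
  have hgi : ∀ i : Fin (N + 1), Measurable fun v : Fin (N + 1) → V3 => g (v i) := fun i =>
    hg.comp (measurable_pi_apply i)
  rw [hfun, lintegral_prod_mul measurable_const.aemeasurable hG.aemeasurable, lintegral_const,
    measure_univ, mul_one, one_mul,
    lintegral_finsetSum (f := fun (i : Fin (N + 1)) (v : Fin (N + 1) → V3) => g (v i)) _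
      fun i _ => hgi i]
  have hev : ∀ i : Fin (N + 1), ∫⁻ v, g (v i) ∂Γ = ∫⁻ v, g v ∂(gaussMeasure u θ) := fun i =>
    (measurePreserving_eval (fun _ : Fin (N + 1) => gaussMeasure u θ) i).lintegral_comp hg
  simp only [hev, Finset.sum_const, Finset.card_univ, Fintype.card_fin, nsmul_eq_mul]

end Summit.AtomisticToContinuum.HydrodynamicLimit.Theorems.EnergyCurrentTailsLevelCensus

end
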